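import Literature.NumberTheory.LFunctions.Zhang2022.AppendixALemma83Edge
import Literature.NumberTheory.LFunctions.Zhang2022.AppendixAFraktHolomorphic
import Literature.NumberTheory.LFunctions.Zhang2022.AppendixALemma83ClosedForms
import Literature.NumberTheory.LFunctions.Zhang2022.RepairGapAppendixACaseOneFree
import Literature.NumberTheory.LFunctions.Zhang2022.RepairGapAppendixAPowSumFree
import HarnessLib

/-!
# Zhang (2022), rescue GAP/BED (D-0124 (3)(4)): Lemma 8.3 (relative form) GUARD-FREE — the Appendix A
# aggregation edge re-run without Assumption (A)

Topic `Literature/NumberTheory/LFunctions/Zhang2022` (Landau–Siegel audit tree; verdict-neutral).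
Y. Zhang, *Discrete mean estimates and the Landau–Siegel zero*, arXiv:2211.02515v1 (2022)
[Zhang2022LandauSiegel] — **an unrefereed manuscript under adjudication; nothing in this file asserts or
denies its Theorems 1–2, and nothing here is a claim about Landau–Siegel zeros. The programme SEARCHES and
TYPES; no claim about Landau–Siegel zeros, Theorems 1–2 of arXiv:2211.02515 or a repaired Margin232 until a
kernel theorem says so.**

Lemma 8.3 in its relative form of record (`Skeleton.Lemma83Rel c′`, §8 p. 46, GAP row G-d55-3) is a
tree theorem (`Skeleton.lemma83Rel_holds`) through the Appendix A chain: the aggregation edge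
`Lemma83.lemma83Rel_of_parts` over the two global sentences of §A.u007 (`StepA_u007_analytic`, `StepA_u007_read`)
and the local steps (A.1)–(A.3), `𝔱_j = 1` at `q ∣ D`, the local bounds at `q ∣ dh` / `(q,dh) = 1`, Mertens.
Every node of that chain is typed under the standing guard `AssumptionA D χ →` and NO proof in it uses the guard
(Appendix A is local Euler-factor algebra in `α`, `β_i`, `q`). This file completes the guard-free re-run:

* `stepA_u007_analytic_free`, `stepA_u007_read_free` — the two §A.u007 sentences without the guard (the tree's
  guard-free engines `Lemma83.differentiableOn_eulerProduct_frakt`, `tprod_frakt_eq_calU`,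
  `eqOn_tprod_frakt_of_continuation`, `norm_tprod_frakt_sub_prod_le`; `c = 3/10`);
* `stepA_u007_dvd_free`, `stepA_u007_local_free` — the local bounds (engines `norm_frakt_le_of_dvd`,
  `norm_frakt_sub_one_le`; constants `12`, `26·10⁶`);
* `lemma83Rel_free` — **the body of `Skeleton.Lemma83Rel c′` with the guard `AssumptionA D χ →` DELETED**, for every
  `c′`: the proof of `Lemma83.lemma83Rel_of_parts` VERBATIM (same `Cmax`, same threshold `L₀`) over the guard-free
  inputs `eqA_1_free` / `eqA_2_free` / `eqA_3_free` (files `RepairGapAppendixACaseOneFree`, `RepairGapAppendixAPowSumFree`)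
  and the four theorems above.

Consequence (next file, `RepairGapLemma84LeafUnconditional`): the hypothesis of
`Lemma84.lemma84Rel_pow15_of_lemma83Rel_pow15` (Lemma 8.3 (rel) under the `𝓛⁻¹⁵` guard) holds, so the Lemma 8.4 leaf
is kernel at (A)-exponent 15 (rescue GAP row G-31). Theorems only; no definition, no named fact; nothing about
(A) itself, and `χ.IsQuadratic` is still used (the main-factor bound `|m_q| ≤ (1−q⁻¹)⁻¹`). Private real-analysis
helpers copied unchanged from `AppendixALemma83Edge`; the public main-factor lemmas (`norm_main_le`,
`PiW_eq_prod_main`, `sum_log_div_primesBelow_le`) are the tree's.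

## References

* Y. Zhang, arXiv:2211.02515v1 (2022), App. A pp. 101–103 (tex L4984–L5019); §8 Lemma 8.3 p. 46.
  [cite: Zhang2022LandauSiegel, App. A; §8 Lemma 8.3] [cite: HardyWright2008, Thm 425]
-/

noncomputable section

open Complex Real ComplexConjugate Finset

namespace Literature.NumberTheory.LFunctions.Zhang2022.Repair.Gap

open Literature.NumberTheory.LFunctions.Zhang2022
open Literature.NumberTheory.LFunctions.Zhang2022.Skeleton
open Literature.NumberTheory.LFunctions.Zhang2022.MeanSquareMajorant
open Literature.NumberTheory.LFunctions.Zhang2022.Typed.AppendixA1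
open Literature.NumberTheory.LFunctions.Zhang2022.Lemma83

/-! ## Private helpers (copied from `AppendixALemma83Edge`) -/

/-- **Absolute product perturbation**: if `‖M_i‖ ≤ B_i` with `B_i ≥ 1` and `‖F_i − M_i‖ ≤ e_i`
(`e_i ≥ 0`) on a finset, then `‖∏F − ∏M‖ ≤ (∏B)·(exp(Σe) − 1)`. Unlike the relative form this
allows `M_i = 0`. [folklore] -/
private theorem norm_prod_sub_prod_le_abs {ι : Type*} (S : Finset ι) (F M : ι → ℂ) (B e : ι → ℝ)
    (hB : ∀ i ∈ S, ‖M i‖ ≤ B i) (hB1 : ∀ i ∈ S, 1 ≤ B i) (he : ∀ i ∈ S, ‖F i - M i‖ ≤ e i) :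
    ‖∏ i ∈ S, F i - ∏ i ∈ S, M i‖ ≤ (∏ i ∈ S, B i) * (Real.exp (∑ i ∈ S, e i) - 1) := by
  classical
  induction S using Finset.induction_on with
  | empty => simp
  | insert a s ha ih =>
    have hB' : ∀ i ∈ s, ‖M i‖ ≤ B i := fun i hi => hB i (Finset.mem_insert_of_mem hi)
    have hB1' : ∀ i ∈ s, 1 ≤ B i := fun i hi => hB1 i (Finset.mem_insert_of_mem hi)
    have he' : ∀ i ∈ s, ‖F i - M i‖ ≤ e i := fun i hi => he i (Finset.mem_insert_of_mem hi)
    have ih' := ih hB' hB1' he'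
    have hBa := hB a (Finset.mem_insert_self a s)
    have hB1a := hB1 a (Finset.mem_insert_self a s)
    have hea := he a (Finset.mem_insert_self a s)
    have he0 : 0 ≤ e a := le_trans (norm_nonneg _) hea
    rw [Finset.prod_insert ha, Finset.prod_insert ha, Finset.prod_insert ha, Finset.sum_insert ha]
    set PF := ∏ i ∈ s, F i
    set PM := ∏ i ∈ s, M i
    set PB := ∏ i ∈ s, B i
    set Es := ∑ i ∈ s, e i
    have hPB : 0 ≤ PB := Finset.prod_nonneg fun i hi => le_trans zero_le_one (hB1' i hi)
    have hPM : ‖PM‖ ≤ PB := by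
      rw [show PM = ∏ i ∈ s, M i from rfl, Complex.norm_prod]
      exact Finset.prod_le_prod (fun i _ => norm_nonneg _) hB'
    have hX : 1 ≤ Real.exp Es := Real.one_le_exp (Finset.sum_nonneg fun i hi => le_trans (norm_nonneg _) (he' i hi))
    have hFa : ‖F a‖ ≤ B a + e a := by
      have := norm_sub_norm_le (F a) (M a)
      linarith
    have e1 : F a * PF - M a * PM = F a * (PF - PM) + (F a - M a) * PM := by ring
    rw [e1]
    calc ‖F a * (PF - PM) + (F a - M a) * PM‖ ≤ ‖F a‖ * ‖PF - PM‖ + ‖F a - M a‖ * ‖PM‖ := by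
          rw [← norm_mul, ← norm_mul]; exact norm_add_le _ _
      _ ≤ (B a + e a) * (PB * (Real.exp Es - 1)) + e a * PB := by
          gcongr
      _ ≤ B a * PB * (Real.exp (e a + Es) - 1) := by
          rw [Real.exp_add]
          have h1 : e a ≤ Real.exp (e a) - 1 := by linarith [Real.add_one_le_exp (e a)]
          have h2 : 0 ≤ Real.exp Es - 1 := by linarith
          -- `(B+e)(X−1) + e ≤ B(X·e^{e} − 1)` for `X ≥ 1`, `B ≥ 1`
          nlinarith [mul_nonneg hPB h2, mul_nonneg hPB he0, mul_nonneg (mul_nonneg hPB (by linarith : (0:ℝ) ≤ B a - 1)) he0,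
            mul_le_mul_of_nonneg_left h1 (mul_nonneg (mul_nonneg hPB (le_trans zero_le_one hB1a)) (le_trans zero_le_one hX)),
            Real.add_one_le_exp (e a), hX]

/-- For a prime `q`: `‖1 − q⁻¹‖ = 1 − q⁻¹ ≥ 1/2` (as complex numbers). [folklore] -/
private theorem norm_one_sub_inv_prime {q : ℕ} (hq : q.Prime) :
    ‖(1 : ℂ) - (q : ℂ)⁻¹‖ = 1 - (q : ℝ)⁻¹ ∧ (1 : ℝ) / 2 ≤ 1 - (q : ℝ)⁻¹ ∧ (q : ℝ)⁻¹ ≤ 1 / 2 := by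
  have hq2 : (2 : ℝ) ≤ q := by exact_mod_cast hq.two_le
  have hqinv : (q : ℝ)⁻¹ ≤ 1 / 2 := inv_le_of_inv_le₀ (by norm_num) (by linarith)
  have e : (1 : ℂ) - (q : ℂ)⁻¹ = ((1 - (q : ℝ)⁻¹ : ℝ) : ℂ) := by push_cast; ring
  refine ⟨?_, by linarith, hqinv⟩
  rw [e, Complex.norm_real, Real.norm_eq_abs, abs_of_nonneg (by linarith)]

/-- `1 ≤ (1 − q⁻¹)⁻¹` for a prime `q`. [folklore] -/
private theorem one_le_inv_one_sub_inv {q : ℕ} (hq : q.Prime) : (1 : ℝ) ≤ (1 - (q : ℝ)⁻¹)⁻¹ := by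
  obtain ⟨_, hhalf, _⟩ := norm_one_sub_inv_prime hq
  have hq0 : (0 : ℝ) < q := by exact_mod_cast hq.pos
  exact (one_le_inv₀ (by linarith)).mpr (by linarith [inv_nonneg.mpr hq0.le])

/-- The prime factors of `dr` that are `≥ D` are few: `#{q ∣ dr prime, q ≥ D}·log D ≤ log(dr)`.
[folklore] -/
private theorem card_large_primeFactors_mul_log_le {n D : ℕ} (hn : 1 ≤ n) (hD : 2 ≤ D) :
    (((n.primeFactors.filter (fun q => D ≤ q)).card : ℝ)) * Real.log D ≤ Real.log n := by
  set S := n.primeFactors.filter (fun q => D ≤ q) with hS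
  have hD0 : (0 : ℝ) < D := by exact_mod_cast (show 0 < D by omega)
  have hprod_dvd : (∏ q ∈ S, q) ∣ n :=
    (Finset.prod_dvd_prod_of_subset _ _ _ (Finset.filter_subset _ _)).trans (Nat.prod_primeFactors_dvd n)
  have hprod_le : ((∏ q ∈ S, q : ℕ) : ℝ) ≤ n := by exact_mod_cast Nat.le_of_dvd (by omega) hprod_dvd
  have hpow : (D : ℝ) ^ S.card ≤ ((∏ q ∈ S, q : ℕ) : ℝ) := by
    push_cast
    rw [← Finset.prod_const]
    exact Finset.prod_le_prod (fun _ _ => hD0.le) (fun q hq => by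
      have := (Finset.mem_filter.mp hq).2; exact_mod_cast this)
  have hn0 : (0 : ℝ) < n := by exact_mod_cast (show 0 < n by omega)
  have h := Real.log_le_log (by positivity) (hpow.trans hprod_le)
  rwa [Real.log_pow] at h

/-- Products of reals over a sub-finset: if the factors are `≥ 0` on `s` and `≥ 1` on `t ∖ s` then
`∏_s f ≤ ∏_t f`. [folklore] -/
private theorem prod_le_prod_of_subset_real {ι : Type*} [DecidableEq ι] {s t : Finset ι} (f : ι → ℝ)
    (hst : s ⊆ t) (hs : ∀ i ∈ s, 0 ≤ f i) (ht : ∀ i ∈ t, i ∉ s → 1 ≤ f i) :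
    ∏ i ∈ s, f i ≤ ∏ i ∈ t, f i := by
  rw [← Finset.prod_sdiff hst]
  have h1 : (1 : ℝ) ≤ ∏ i ∈ t \ s, f i := by
    rw [← Finset.prod_const_one (s := t \ s)]
    refine Finset.prod_le_prod (fun _ _ => zero_le_one) fun i hi => ?_
    exact ht i (Finset.mem_sdiff.mp hi).1 (Finset.mem_sdiff.mp hi).2
  have h0 : 0 ≤ ∏ i ∈ s, f i := Finset.prod_nonneg hs
  exact le_mul_of_one_le_left h0 h1

/-- `∏(1 + x_i) ≤ exp(Σ x_i)` for `x_i ≥ 0`. [folklore] -/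
private theorem prod_one_add_le_exp_sum {ι : Type*} (s : Finset ι) (x : ι → ℝ) (hx : ∀ i ∈ s, 0 ≤ x i) :
    ∏ i ∈ s, (1 + x i) ≤ Real.exp (∑ i ∈ s, x i) := by
  rw [Real.exp_sum]
  exact Finset.prod_le_prod (fun i hi => by linarith [hx i hi]) fun i _ => by
    linarith [Real.add_one_le_exp (x i)]

/-- `exp x − 1 ≤ 2x` for `0 ≤ x ≤ 1`. [folklore] -/
private theorem exp_sub_one_le_two_mul {x : ℝ} (h0 : 0 ≤ x) (h1 : x ≤ 1) : Real.exp x - 1 ≤ 2 * x := by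
  have h := Real.abs_exp_sub_one_sub_id_le (show |x| ≤ 1 by rw [abs_of_nonneg h0]; exact h1)
  have h2 : Real.exp x - 1 - x ≤ x ^ 2 := le_trans (le_abs_self _) h
  nlinarith

/-- `ℓ^k·e^{−cℓ} ≤ 1` once `ℓ ≥ (k+1)!/c^{k+1}` (`c > 0`, `ℓ > 0`): from `(cℓ)^{k+1}/(k+1)! ≤ e^{cℓ}`.
[folklore] -/
private theorem pow_mul_exp_neg_le_one {c ℓ : ℝ} (hc : 0 < c) (hℓ : 0 < ℓ) (k : ℕ)
    (hbig : (Nat.factorial (k + 1) : ℝ) / c ^ (k + 1) ≤ ℓ) : ℓ ^ k * Real.exp (-(c * ℓ)) ≤ 1 := by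
  have h := Real.pow_div_factorial_le_exp (x := c * ℓ) (by positivity) (k + 1)
  have hfac : (0 : ℝ) < Nat.factorial (k + 1) := by exact_mod_cast Nat.factorial_pos _
  have hck : 0 < c ^ (k + 1) := pow_pos hc _
  rw [Real.exp_neg, ← div_eq_mul_inv, div_le_one (Real.exp_pos _)]
  refine le_trans ?_ h
  rw [le_div_iff₀ hfac, mul_pow, pow_succ ℓ k]
  rw [div_le_iff₀ hck] at hbig
  -- `ℓ^k · (k+1)! ≤ c^{k+1} ℓ^k ℓ` since `(k+1)! ≤ c^{k+1} ℓ`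
  have hℓk : 0 ≤ ℓ ^ k := pow_nonneg hℓ.le k
  nlinarith [mul_le_mul_of_nonneg_left hbig hℓk]

/-- `log D ≥ L₀` once `D ≥ ⌈exp L₀⌉₊`. [folklore] -/
private theorem ell_ge_of_ge_ceil_exp {L₀ : ℝ} {D : ℕ} (hD : ⌈Real.exp L₀⌉₊ ≤ D) : L₀ ≤ ell D := by
  have hD' : Real.exp L₀ ≤ D := le_trans (Nat.le_ceil _) (by exact_mod_cast hD)
  have hD0 : (0 : ℝ) < D := lt_of_lt_of_le (Real.exp_pos _) hD'
  rw [ell]; exact (Real.le_log_iff_exp_le hD0).mpr hD'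

/-! ## The two §A.u007 sentences and the two local bounds, guard-free -/

/-- **Z22:§A.u007, first sentence, GUARD-FREE** (App. A p. 101, tex L4999: "so `𝒰_j(d,h;s)` is analytic in this
region"; twin of `Typed.AppendixA1.stepA_u007_analytic_holds` with the unused binder `AssumptionA D χ` deleted):
for every `D`, every real primitive `χ`, `1 ≤ j ≤ 3`, `d, h ≥ 1`, `dh < PT⁻²`, the function `𝒰_j(d,h;·)` continues
analytically to `σ > 9/10` — witness `∏'_q 𝔱_j(d,h,·;q)` (`Lemma83.differentiableOn_eulerProduct_frakt`,
`tprod_frakt_eq_calU`). [cite: Zhang2022LandauSiegel, App. A p.101, tex L4999] -/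
theorem stepA_u007_analytic_free (c' : ℝ) :
    ForAllLarge fun D _ χ => ∀ j ∈ ({1, 2, 3} : Finset ℕ), ∀ d h : ℕ,
      1 ≤ d → 1 ≤ h → ((d * h : ℕ) : ℝ) < bigP D / bigT D ^ 2 →
        ∃ U : ℂ → ℂ, DifferentiableOn ℂ U {s : ℂ | 9 / 10 < s.re} ∧
          ∀ s : ℂ, 1 < s.re → U s = calU c' χ j d h s :=
  ⟨0, fun _ _ χ _ _ _ j hj d h hd hh _ =>
    ⟨fun s => ∏' q : Nat.Primes, frakt c' χ j d h s q, differentiableOn_eulerProduct_frakt c' χ hj hd hh,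
      fun _ hs => tprod_frakt_eq_calU c' χ j hd hh hs⟩⟩

/-- **Z22:§A.u007, second sentence (prefactor-free reading), GUARD-FREE** (App. A p. 101, tex L5000:
"`𝒰_j(d,h;s) = ∏_{q<D} 𝔱_j(d,h,s;q) + O(D^{−c})`" in `σ > 9/10`, for every continuation `U`, `c = 3/10`; twin of
`Typed.AppendixA1.stepA_u007_read_holds` / `Lemma83.stepA_u007_read_of_core` with the unused binder `AssumptionA D χ`
deleted): identity theorem (`eqOn_tprod_frakt_of_continuation`) + the absolute tail bound
`norm_tprod_frakt_sub_prod_le` (which uses no (A), no primitivity, no quadraticity).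
[cite: Zhang2022LandauSiegel, App. A p.101, tex L5000] -/
theorem stepA_u007_read_free (c' : ℝ) :
    ∃ c : ℝ, 0 < c ∧ ∃ C : ℝ, ForAllLarge fun D _ χ =>
      ∀ j ∈ ({1, 2, 3} : Finset ℕ), ∀ d h : ℕ, 1 ≤ d → 1 ≤ h →
        ((d * h : ℕ) : ℝ) < bigP D / bigT D ^ 2 → ∀ U : ℂ → ℂ,
          DifferentiableOn ℂ U {s : ℂ | 9 / 10 < s.re} → (∀ s : ℂ, 1 < s.re → U s = calU c' χ j d h s) →
            ∀ s : ℂ, 9 / 10 < s.re →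
              ‖U s - ∏ q ∈ Nat.primesBelow D, frakt c' χ j d h s q‖ ≤ C * (D : ℝ) ^ (-c) := by
  obtain ⟨C, D₁, hT⟩ := norm_tprod_frakt_sub_prod_le c'
  refine ⟨3 / 10, by norm_num, C, D₁, fun D _ χ hD _ _ j hj d h hd hh hdh U hU hUeq s hs => ?_⟩
  have hdiff := differentiableOn_eulerProduct_frakt c' χ hj hd hh
  have hid : ∀ s : ℂ, 1 < s.re → (∏' q : Nat.Primes, frakt c' χ j d h s q) = calU c' χ j d h s :=
    fun s hs => tprod_frakt_eq_calU c' χ j hd hh hs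
  have hEq := eqOn_tprod_frakt_of_continuation c' χ hdiff hid hU hUeq
  have hUs : U s = ∏' q : Nat.Primes, frakt c' χ j d h s q := hEq hs
  have hdhP : ((d * h : ℕ) : ℝ) < bigP D := hdh.trans_le (bigP_div_bigT_sq_le D)
  rw [hUs]
  exact hT D χ hD j hj d h hd hh hdhP s hs

/-- **The local bound at `q ∣ dh`, GUARD-FREE** (GAP row G-d55-2; twin of `Lemma83.stepA_u007_dvd` with the unused
binder `AssumptionA D χ` deleted): for `q ∣ dh`, `q ∤ D`, `σ > 9/10`: `‖𝔱_j(d,h,s;q)‖ ≤ 1 + 12·q^{−σ}` (engine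
`norm_frakt_le_of_dvd`, every `D`). [cite: Zhang2022LandauSiegel, §8 Lemma 8.3] -/
theorem stepA_u007_dvd_free (c' : ℝ) :
    ∃ c : ℝ, ForAllLarge fun D _ χ => ∀ j ∈ ({1, 2, 3} : Finset ℕ), ∀ d h : ℕ,
      1 ≤ d → 1 ≤ h → ((d * h : ℕ) : ℝ) < bigP D / bigT D ^ 2 → ∀ q : ℕ, q.Prime → q ∣ d * h →
        ¬ q ∣ D → ∀ s : ℂ, 9 / 10 < s.re →
          ‖frakt c' χ j d h s q‖ ≤ 1 + c * (q : ℝ) ^ (-s.re) :=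
  ⟨12, 0, fun _ _ χ _ _ _ _ hj _ _ hd hh _ _ hq hqdh _ s hs =>
    norm_frakt_le_of_dvd c' χ hj hd hh hq hqdh s hs⟩

/-- **The local clause of Z22:§A.u007, GUARD-FREE** (App. A p. 101, tex L4999; twin of
`Lemma83.stepA_u007_local_holds` with the unused binder `AssumptionA D χ` deleted): for every prime `q` with
`(q,dh) = 1` and `σ > 9/10`, `‖𝔱_j(d,h,s;q) − 1‖ ≤ 26·10⁶·q^{−9/5}` (engine `norm_frakt_sub_one_le`, every `D`).
[cite: Zhang2022LandauSiegel, App. A p. 101, tex L4999] -/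
theorem stepA_u007_local_free (c' : ℝ) :
    ∃ C : ℝ, ForAllLarge fun D _ χ => ∀ j ∈ ({1, 2, 3} : Finset ℕ), ∀ d h : ℕ,
      1 ≤ d → 1 ≤ h → ((d * h : ℕ) : ℝ) < bigP D / bigT D ^ 2 → ∀ q : ℕ, q.Prime →
        Nat.Coprime q (d * h) → ∀ s : ℂ, 9 / 10 < s.re →
          ‖frakt c' χ j d h s q - 1‖ ≤ C * (q : ℝ) ^ (-(9 / 5 : ℝ)) := by
  refine ⟨26000000, 0, fun D _ χ _ _ _ j hj d h _ _ _ q hq hcop s hs => ?_⟩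
  have hqd : ¬ q ∣ d := fun h' => ((Nat.Prime.coprime_iff_not_dvd hq).mp hcop) (dvd_mul_of_dvd_left h' h)
  have hqh : ¬ q ∣ h := fun h' => ((Nat.Prime.coprime_iff_not_dvd hq).mp hcop) (dvd_mul_of_dvd_right h' d)
  exact norm_frakt_sub_one_le c' χ hj hq hqd hqh hs

/-! ## Lemma 8.3 (relative form), guard-free -/

set_option maxHeartbeats 1600000 in
/-- **Lemma 8.3 (relative form) GUARD-FREE** — the body of `Skeleton.Lemma83Rel c′` (§8 p. 46, GAP row G-d55-3) with
the standing guard `AssumptionA D χ →` deleted: for all large `D`, every REAL PRIMITIVE `χ (mod D)` with NO hypothesis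
on `L(1,χ)`, `1 ≤ j ≤ 3`, `d, r ≥ 1`, `dr < PT⁻²`: `𝒰_j(d,r;s)` continues analytically to `σ > 9/10`, is
`≪ ∏_{q∣dr}(1 + Cq^{−σ})` there, and `|𝒰_j(d,r;s) − Π(d,r)| ≤ C𝓛⁻⁸∏_{q∣dr}(1−q⁻¹)⁻¹` for `|s−1| ≤ 5α`. The proof
of the aggregation edge `Lemma83.lemma83Rel_of_parts` VERBATIM (same constant `Cmax`, same threshold), over the
guard-free inputs `stepA_u007_analytic_free`, `stepA_u007_read_free`, `eqA_1_free`, `eqA_2_free`, `eqA_3_free`,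
`stepA_u007_dvd_free`, `stepA_u007_local_free`, `Typed.AppendixA1.stepA_u008_dvd_holds` and Mertens. In particular
it implies `Skeleton.Lemma83Rel c′` and its `𝓛⁻¹⁵`-guarded twin (next file).
[cite: Zhang2022LandauSiegel, App. A pp. 101–103; §8 Lemma 8.3 p. 46] -/
theorem lemma83Rel_free (c' : ℝ) :
    ∃ C : ℝ, ForAllLarge fun D _ χ =>
      ∀ j ∈ ({1, 2, 3} : Finset ℕ), ∀ d r : ℕ, 1 ≤ d → 1 ≤ r → ((d * r : ℕ) : ℝ) < bigP D / bigT D ^ 2 →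
        ∃ U : ℂ → ℂ, DifferentiableOn ℂ U {s : ℂ | 9 / 10 < s.re} ∧
          (∀ s : ℂ, 1 < s.re → U s = χ.LFunction s /
              (χ.LFunction (s + betaJ c' D (j + 1)) * χ.LFunction (s + betaJ c' D (j + 2))) *
                xiSeries c' χ j d r s) ∧
          (∀ s : ℂ, 9 / 10 < s.re →
            ‖U s‖ ≤ C * ∏ q ∈ (d * r).primeFactors, (1 + C * (q : ℝ) ^ (-s.re))) ∧
          (∀ s : ℂ, ‖s - 1‖ ≤ 5 * alpha D →
            ‖U s - PiW χ d r‖ ≤ C * (ell D ^ 8)⁻¹ * ∏ q ∈ (d * r).primeFactors, (1 - (q : ℝ)⁻¹)⁻¹) := by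
  have hAn := stepA_u007_analytic_free c'
  obtain ⟨c, hc, C_R, hR⟩ := stepA_u007_read_free c'
  obtain ⟨C₁, h1⟩ := eqA_1_free c'
  obtain ⟨C₂, h2⟩ := eqA_2_free c'
  obtain ⟨C₃, h3⟩ := eqA_3_free c'
  obtain ⟨c₇, h7⟩ := stepA_u007_dvd_free c'
  obtain ⟨C_L, hL⟩ := stepA_u007_local_free c'
  -- absolute constants
  have hsumm : Summable (fun n : ℕ => (n : ℝ) ^ (-(9 / 5 : ℝ))) :=
    Real.summable_nat_rpow.mpr (by norm_num)
  set K : ℝ := ∑' n : ℕ, (n : ℝ) ^ (-(9 / 5 : ℝ)) with hKdef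
  have hK0 : 0 ≤ K := tsum_nonneg fun n => Real.rpow_nonneg (Nat.cast_nonneg n) _
  set CA : ℝ := |C₁| + |C₂| + |C₃| with hCAdef
  have hCA0 : 0 ≤ CA := by positivity
  set Cii : ℝ := Real.exp (|C_L| * K) + |C_R| + |c₇| + 1 with hCiidef
  set Ciii : ℝ := |C_R| + 4 * π * CA + 1 with hCiiidef
  set Cmax : ℝ := Cii + Ciii with hCmaxdef
  have hCii1 : 1 ≤ Cii := by
    rw [hCiidef]; linarith [Real.exp_pos (|C_L| * K), abs_nonneg C_R, abs_nonneg c₇]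
  have hCiii0 : 0 ≤ Ciii := by rw [hCiiidef]; positivity
  have hCii_le : Cii ≤ Cmax := by rw [hCmaxdef]; linarith
  have hCiii_le : Ciii ≤ Cmax := by rw [hCmaxdef]; linarith
  have hc7_le : |c₇| ≤ Cmax := by
    have := Real.exp_pos (|C_L| * K); rw [hCmaxdef, hCiidef]; linarith [abs_nonneg C_R]
  -- the largeness threshold
  set L₀ : ℝ := max (10 * |c'| * π + 400) (max (2 * CA * π + 1)
    (max ((Nat.factorial 18 : ℝ)) ((Nat.factorial 9 : ℝ) / c ^ 9 + 1))) with hL₀def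
  set D₁ : ℕ := ⌈Real.exp L₀⌉₊ with hD₁def
  have hlarge : ForAllLarge fun D _ _ => D₁ ≤ D := ForAllLarge.of_le D₁ fun D _ _ hD _ _ => hD
  have hAll := ((((((hAn.and hR).and h1).and h2).and h3).and h7).and hL).and hlarge
  refine ⟨Cmax, hAll.mono fun D _ χ hquad _ hS j hj d r hd hr hdr => ?_⟩
  obtain ⟨⟨⟨⟨⟨⟨⟨hAn', hR'⟩, h1'⟩, h2'⟩, h3'⟩, h7'⟩, hL'⟩, hD₁⟩ := hS
  clear hR h1 h2 h3 h7 hL hAn hlarge hAll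
  -- largeness consequences
  have hℓL₀ : L₀ ≤ ell D := ell_ge_of_ge_ceil_exp hD₁
  have hℓ1 : 10 * |c'| * π + 400 ≤ ell D := le_trans (le_max_left _ _) hℓL₀
  have hℓ2 : 2 * CA * π + 1 ≤ ell D := le_trans (le_trans (le_max_left _ _) (le_max_right _ _)) hℓL₀
  have hℓ3 : (Nat.factorial 18 : ℝ) ≤ ell D :=
    le_trans (le_trans (le_trans (le_max_left _ _) (le_max_right _ _)) (le_max_right _ _)) hℓL₀
  have hℓ4 : (Nat.factorial 9 : ℝ) / c ^ 9 + 1 ≤ ell D :=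
    le_trans (le_trans (le_trans (le_max_right _ _) (le_max_right _ _)) (le_max_right _ _)) hℓL₀
  have hD0 : 0 < D := by
    by_contra h0
    have : D = 0 := by omega
    have hℓ : ell D = 0 := by rw [ell, this]; simp
    have : 0 ≤ 10 * |c'| * π := by positivity
    linarith
  have hD0r : (0 : ℝ) < D := by exact_mod_cast hD0
  have hDexp : Real.exp (10 * |c'| * π + 400) ≤ D := by
    rw [show (D : ℝ) = Real.exp (ell D) by rw [ell, Real.exp_log hD0r]]
    exact Real.exp_le_exp.mpr hℓ1
  obtain ⟨hℓ3', hα0, _, hαℓ⟩ := largeD_bounds c' hDexp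
  have hℓ0 : 0 < ell D := by linarith
  have hα_le : alpha D ≤ 1 / 336 := by
    have : alpha D * 3 ≤ alpha D * ell D := by nlinarith
    linarith
  have hD2 : 2 ≤ D := by
    by_contra h2
    have : D = 1 := by omega
    have : ell D = 0 := by rw [ell, this]; simp
    linarith
  -- the objects
  obtain ⟨U, hUdiff, hUeq⟩ := hAn' j hj d r hd hr hdr
  have hdr0 : d * r ≠ 0 := mul_ne_zero (by omega) (by omega)
  have hUcont : ContinuousOn U {s : ℂ | 9 / 10 < s.re} := hUdiff.continuousOn
  refine ⟨U, hUdiff, fun s hs => hUeq s hs, fun s hs => ?_, ?_⟩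
  · /- (ii) the bound on `σ > 9/10` -/
    set T : ℂ := ∏ q ∈ Nat.primesBelow D, frakt c' χ j d r s q with hTdef
    have hRs : ‖U s - T‖ ≤ C_R * (D : ℝ) ^ (-c) := hR' j hj d r hd hr hdr U hUdiff hUeq s hs
    -- `D^{-c} ≤ 1`
    have hDc : (D : ℝ) ^ (-c) ≤ 1 := by
      have hD1 : (1 : ℝ) ≤ D := by exact_mod_cast hD0
      exact Real.rpow_le_one_of_one_le_of_nonpos hD1 (by linarith)
    have hUle : ‖U s‖ ≤ ‖T‖ + |C_R| := by
      have h := norm_le_norm_add_norm_sub' (U s) T  -- ‖U s‖ ≤ ‖T‖ + ‖U s - T‖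
      calc ‖U s‖ ≤ ‖T‖ + ‖U s - T‖ := h
        _ ≤ ‖T‖ + C_R * (D : ℝ) ^ (-c) := by linarith [hRs]
        _ ≤ ‖T‖ + |C_R| := by
            have : C_R * (D : ℝ) ^ (-c) ≤ |C_R| * 1 := by
              calc C_R * (D : ℝ) ^ (-c) ≤ |C_R| * (D : ℝ) ^ (-c) :=
                    mul_le_mul_of_nonneg_right (le_abs_self _) (Real.rpow_nonneg hD0r.le _)
                _ ≤ |C_R| * 1 := mul_le_mul_of_nonneg_left hDc (abs_nonneg _)
            linarith
    -- the per-prime bounds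
    set g : ℕ → ℝ := fun q => if q ∣ d * r then 1 + |c₇| * (q : ℝ) ^ (-s.re)
      else 1 + |C_L| * (q : ℝ) ^ (-(9 / 5 : ℝ)) with hgdef
    have hTq : ∀ q ∈ Nat.primesBelow D, ‖frakt c' χ j d r s q‖ ≤ g q := by
      intro q hq
      obtain ⟨hqD, hqp⟩ := Nat.mem_primesBelow.mp hq
      have hq0 : (0 : ℝ) ≤ (q : ℝ) := Nat.cast_nonneg q
      by_cases hqdr : q ∣ d * r
      · rw [hgdef]; simp only [if_pos hqdr]
        by_cases hqDd : q ∣ D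
        · rw [stepA_u008_dvd_holds c' D χ j d r q hqp hqDd s, norm_one]
          have : 0 ≤ |c₇| * (q : ℝ) ^ (-s.re) := mul_nonneg (abs_nonneg _) (Real.rpow_nonneg hq0 _)
          linarith
        · have h := h7' j hj d r hd hr hdr q hqp hqdr hqDd s hs
          calc ‖frakt c' χ j d r s q‖ ≤ 1 + c₇ * (q : ℝ) ^ (-s.re) := h
            _ ≤ 1 + |c₇| * (q : ℝ) ^ (-s.re) := by
                gcongr; exact le_abs_self _
      · rw [hgdef]; simp only [if_neg hqdr]
        have hcop : Nat.Coprime q (d * r) := (Nat.Prime.coprime_iff_not_dvd hqp).mpr hqdr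
        have h := hL' j hj d r hd hr hdr q hqp hcop s hs
        calc ‖frakt c' χ j d r s q‖ ≤ ‖(1 : ℂ)‖ + ‖frakt c' χ j d r s q - 1‖ := norm_le_insert' _ _
          _ ≤ 1 + C_L * (q : ℝ) ^ (-(9 / 5 : ℝ)) := by rw [norm_one]; linarith
          _ ≤ 1 + |C_L| * (q : ℝ) ^ (-(9 / 5 : ℝ)) := by gcongr; exact le_abs_self _
    have hTle : ‖T‖ ≤ ∏ q ∈ Nat.primesBelow D, g q := by
      rw [hTdef, Complex.norm_prod]
      exact Finset.prod_le_prod (fun _ _ => norm_nonneg _) hTq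
    -- split the majorant product
    have hsplit : ∏ q ∈ Nat.primesBelow D, g q =
        (∏ q ∈ (Nat.primesBelow D).filter (fun q => q ∣ d * r), (1 + |c₇| * (q : ℝ) ^ (-s.re))) *
          ∏ q ∈ (Nat.primesBelow D).filter (fun q => ¬ q ∣ d * r),
            (1 + |C_L| * (q : ℝ) ^ (-(9 / 5 : ℝ))) := by
      rw [hgdef]
      exact Finset.prod_ite (s := Nat.primesBelow D) (p := fun q => q ∣ d * r)
        (f := fun q => 1 + |c₇| * (q : ℝ) ^ (-s.re)) (g := fun q => 1 + |C_L| * (q : ℝ) ^ (-(9 / 5 : ℝ)))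
    have hP7 : ∏ q ∈ (Nat.primesBelow D).filter (fun q => q ∣ d * r), (1 + |c₇| * (q : ℝ) ^ (-s.re)) ≤
        ∏ q ∈ (d * r).primeFactors, (1 + |c₇| * (q : ℝ) ^ (-s.re)) := by
      classical
      refine prod_le_prod_of_subset_real _ ?_ (fun q _ => by positivity) (fun q _ _ => ?_)
      · intro q hq
        obtain ⟨hq1, hq2⟩ := Finset.mem_filter.mp hq
        exact Nat.mem_primeFactors.mpr ⟨(Nat.mem_primesBelow.mp hq1).2, hq2, hdr0⟩
      · have : 0 ≤ |c₇| * (q : ℝ) ^ (-s.re) := mul_nonneg (abs_nonneg _) (Real.rpow_nonneg (Nat.cast_nonneg q) _)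
        linarith
    have hPL : ∏ q ∈ (Nat.primesBelow D).filter (fun q => ¬ q ∣ d * r),
        (1 + |C_L| * (q : ℝ) ^ (-(9 / 5 : ℝ))) ≤ Real.exp (|C_L| * K) := by
      refine le_trans (prod_one_add_le_exp_sum _ _ (fun q _ => mul_nonneg (abs_nonneg _)
        (Real.rpow_nonneg (Nat.cast_nonneg q) _))) (Real.exp_le_exp.mpr ?_)
      rw [← Finset.mul_sum]
      refine mul_le_mul_of_nonneg_left ?_ (abs_nonneg _)
      calc ∑ q ∈ (Nat.primesBelow D).filter (fun q => ¬ q ∣ d * r), (q : ℝ) ^ (-(9 / 5 : ℝ))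
          ≤ ∑ q ∈ Nat.primesBelow D, (q : ℝ) ^ (-(9 / 5 : ℝ)) :=
            Finset.sum_le_sum_of_subset_of_nonneg (Finset.filter_subset _ _)
              (fun q _ _ => Real.rpow_nonneg (Nat.cast_nonneg q) _)
        _ ≤ K := hsumm.sum_le_tsum _ (fun q _ => Real.rpow_nonneg (Nat.cast_nonneg q) _)
    have hprod7_ge : 1 ≤ ∏ q ∈ (d * r).primeFactors, (1 + |c₇| * (q : ℝ) ^ (-s.re)) := by
      rw [← Finset.prod_const_one (s := (d * r).primeFactors)]
      refine Finset.prod_le_prod (fun _ _ => zero_le_one) fun q _ => ?_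
      rw [Finset.prod_const_one]
      have : 0 ≤ |c₇| * (q : ℝ) ^ (-s.re) := mul_nonneg (abs_nonneg _) (Real.rpow_nonneg (Nat.cast_nonneg q) _)
      linarith
    have hprod_mono : ∏ q ∈ (d * r).primeFactors, (1 + |c₇| * (q : ℝ) ^ (-s.re)) ≤
        ∏ q ∈ (d * r).primeFactors, (1 + Cmax * (q : ℝ) ^ (-s.re)) := by
      refine Finset.prod_le_prod (fun q _ => ?_) (fun q _ => ?_)
      · have : 0 ≤ |c₇| * (q : ℝ) ^ (-s.re) := mul_nonneg (abs_nonneg _) (Real.rpow_nonneg (Nat.cast_nonneg q) _)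
        linarith
      · gcongr
    set P7 := ∏ q ∈ (d * r).primeFactors, (1 + |c₇| * (q : ℝ) ^ (-s.re)) with hP7def
    have hP70 : 0 ≤ P7 := le_trans zero_le_one hprod7_ge
    have hPLnn : 0 ≤ ∏ q ∈ (Nat.primesBelow D).filter (fun q => ¬ q ∣ d * r),
        (1 + |C_L| * (q : ℝ) ^ (-(9 / 5 : ℝ))) :=
      Finset.prod_nonneg fun q _ => by
        have : 0 ≤ |C_L| * (q : ℝ) ^ (-(9 / 5 : ℝ)) :=
          mul_nonneg (abs_nonneg _) (Real.rpow_nonneg (Nat.cast_nonneg q) _)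
        linarith
    have hTle2 : ‖T‖ ≤ P7 * Real.exp (|C_L| * K) := by
      refine le_trans hTle ?_
      rw [hsplit]
      exact mul_le_mul hP7 hPL hPLnn hP70
    calc ‖U s‖ ≤ ‖T‖ + |C_R| := hUle
      _ ≤ P7 * Real.exp (|C_L| * K) + |C_R| := by linarith
      _ ≤ Cii * P7 := by
          rw [hCiidef]
          have h1 : |C_R| ≤ |C_R| * P7 := le_mul_of_one_le_right (abs_nonneg _) hprod7_ge
          have h2 : 0 ≤ |c₇| * P7 + P7 := by positivity
          have e : (Real.exp (|C_L| * K) + |C_R| + |c₇| + 1) * P7 =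
              P7 * Real.exp (|C_L| * K) + |C_R| * P7 + (|c₇| * P7 + P7) := by ring
          rw [e]; linarith
      _ ≤ Cmax * ∏ q ∈ (d * r).primeFactors, (1 + Cmax * (q : ℝ) ^ (-s.re)) :=
          mul_le_mul hCii_le hprod_mono hP70 (le_trans (le_trans zero_le_one hCii1) hCii_le)
  · /- (iii') the approximation near `s = 1` -/
    -- the main factors and the relative size
    set mA : ℕ → ℂ := fun q => (1 - χ (q : ZMod D) * (q : ℂ)⁻¹)⁻¹ *
      (if q ∣ r then 1 else (1 - (q : ℂ)⁻¹ - χ (q : ZMod D) * (q : ℂ)⁻¹) / (1 - (q : ℂ)⁻¹))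
      with hmAdef
    set Pi1 : ℝ := ∏ q ∈ (d * r).primeFactors, (1 - (q : ℝ)⁻¹)⁻¹ with hPi1def
    have hPi11 : 1 ≤ Pi1 := by
      rw [hPi1def, ← Finset.prod_const_one (s := (d * r).primeFactors)]
      refine Finset.prod_le_prod (fun _ _ => zero_le_one) fun q hq => ?_
      rw [Finset.prod_const_one]
      exact one_le_inv_one_sub_inv (Nat.prime_of_mem_primeFactors hq)
    have hPi10 : 0 ≤ Pi1 := le_trans zero_le_one hPi11
    have hℓ8pos : 0 < ell D ^ 8 := by positivity
    have hαℓ8 : alpha D * ell D = π / ell D ^ 8 := alpha_mul_ell hℓ0.ne'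
    -- `D^{-c} ≤ ℓ^{-8}` and `4ℓ¹⁶ ≤ D`
    have hDeq : (D : ℝ) = Real.exp (ell D) := by rw [ell, Real.exp_log hD0r]
    have hDc8 : (D : ℝ) ^ (-c) ≤ (ell D ^ 8)⁻¹ := by
      have h := pow_mul_exp_neg_le_one hc hℓ0 8 (by
        have : (Nat.factorial (8 + 1) : ℝ) / c ^ (8 + 1) = (Nat.factorial 9 : ℝ) / c ^ 9 := by norm_num
        rw [this]; linarith)
      rw [Real.rpow_def_of_pos hD0r, show Real.log (D : ℝ) = ell D from rfl,
        show ell D * -c = -(c * ell D) by ring]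
      rw [le_inv_comm₀ (Real.exp_pos _) hℓ8pos, ← Real.exp_neg, neg_neg]
      rw [Real.exp_neg] at h
      calc ell D ^ 8 = ell D ^ 8 * (Real.exp (c * ell D))⁻¹ * Real.exp (c * ell D) := by
            field_simp
        _ ≤ 1 * Real.exp (c * ell D) := by gcongr
        _ = Real.exp (c * ell D) := one_mul _
    have hD16 : 4 * ell D ^ 16 ≤ (D : ℝ) := by
      have h := pow_mul_exp_neg_le_one one_pos hℓ0 17 (by
        rw [one_pow, div_one]; exact hℓ3)
      have h18 : (18 : ℝ) ≤ (Nat.factorial 18 : ℝ) := by exact_mod_cast Nat.self_le_factorial 18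
      have hℓ4' : (4 : ℝ) ≤ ell D := by linarith
      have h17 : ell D ^ 17 ≤ Real.exp (ell D) := by
        have h2 := mul_le_mul_of_nonneg_right h (Real.exp_pos (ell D)).le
        have e3 : ell D ^ 17 * Real.exp (-(1 * ell D)) * Real.exp (ell D) = ell D ^ 17 := by
          rw [mul_assoc, ← Real.exp_add, one_mul, neg_add_cancel, Real.exp_zero, mul_one]
        rw [e3, one_mul] at h2
        exact h2
      calc 4 * ell D ^ 16 ≤ ell D * ell D ^ 16 := by gcongr
        _ = ell D ^ 17 := by ring
        _ ≤ (D : ℝ) := by rw [hDeq]; exact h17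
    -- (a) the estimate on the OPEN ball `|s − 1| < 5α`
    have key : ∀ s : ℂ, ‖s - 1‖ < 5 * alpha D →
        ‖U s - PiW χ d r‖ ≤ Ciii * (ell D ^ 8)⁻¹ * Pi1 := by
      intro s hs
      have hs9 : 9 / 10 < s.re := by
        have h := Complex.abs_re_le_norm (s - 1)
        rw [Complex.sub_re, Complex.one_re] at h
        have := (abs_le.mp (le_trans h hs.le)).1
        linarith [hα_le]
      set T : ℂ := ∏ q ∈ Nat.primesBelow D, frakt c' χ j d r s q with hTdef
      have hRs : ‖U s - T‖ ≤ C_R * (D : ℝ) ^ (-c) := hR' j hj d r hd hr hdr U hUdiff hUeq s hs9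
      -- perturbation data on `q < D`
      set M : ℕ → ℂ := fun q => if q ∣ d * r then mA q else 1 with hMdef
      set B : ℕ → ℝ := fun q => if q ∣ d * r then (1 - (q : ℝ)⁻¹)⁻¹ else 1 with hBdef
      set e : ℕ → ℝ := fun q => CA * (alpha D * Real.log q / q) with hedef
      have he0 : ∀ q : ℕ, 0 ≤ alpha D * Real.log q / q := fun q =>
        div_nonneg (mul_nonneg hα0.le (Real.log_natCast_nonneg q)) (Nat.cast_nonneg q)
      have hB_M : ∀ q ∈ Nat.primesBelow D, ‖M q‖ ≤ B q := by
        intro q hq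
        have hqp := (Nat.mem_primesBelow.mp hq).2
        by_cases hqdr : q ∣ d * r
        · simp only [hMdef, hBdef, if_pos hqdr, hmAdef]
          exact (norm_main_le χ hquad hqp r).1
        · simp only [hMdef, hBdef, if_neg hqdr, norm_one]; exact le_refl _
      have hB1 : ∀ q ∈ Nat.primesBelow D, 1 ≤ B q := by
        intro q hq
        have hqp := (Nat.mem_primesBelow.mp hq).2
        by_cases hqdr : q ∣ d * r
        · simp only [hBdef, if_pos hqdr]; exact one_le_inv_one_sub_inv hqp
        · simp only [hBdef, if_neg hqdr]; exact le_refl _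
      have he_q : ∀ q ∈ Nat.primesBelow D, ‖frakt c' χ j d r s q - M q‖ ≤ e q := by
        intro q hq
        obtain ⟨hqD, hqp⟩ := Nat.mem_primesBelow.mp hq
        have hq0 : (q : ℂ) ≠ 0 := by exact_mod_cast hqp.ne_zero
        have h1u : (1 : ℂ) - (q : ℂ)⁻¹ ≠ 0 := by
          obtain ⟨hn, hhalf, _⟩ := norm_one_sub_inv_prime hqp
          intro h0; rw [h0, norm_zero] at hn; linarith
        have heq0 : 0 ≤ e q := by simp only [hedef]; exact mul_nonneg hCA0 (he0 q)
        by_cases hqDd : q ∣ D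
        · -- `q ∣ D`: `𝔱 = 1 = M q`
          have hχ0 : χ (q : ZMod D) = 0 := chi_eq_zero_of_dvd χ hqp hqDd
          have hM1 : M q = 1 := by
            by_cases hqdr : q ∣ d * r
            · simp only [hMdef, if_pos hqdr, hmAdef, hχ0, zero_mul, sub_zero, inv_one, one_mul]
              split_ifs
              · rfl
              · exact div_self h1u
            · simp only [hMdef, if_neg hqdr]
          rw [stepA_u008_dvd_holds c' D χ j d r q hqp hqDd s, hM1, sub_self, norm_zero]
          exact heq0
        · have hcop : Nat.Coprime q D := (Nat.Prime.coprime_iff_not_dvd hqp).mpr hqDd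
          have hcond : CondA9 D s q := ⟨hs, hqD, hcop⟩
          by_cases hqr : q ∣ r
          · have hqdr : q ∣ d * r := dvd_mul_of_dvd_right hqr d
            have h := h2' j hj d r hd hr hdr q hqp s hcond hqr
            have hMq : M q = 1 / (1 - vA χ q * uA q) := by
              simp only [hMdef, if_pos hqdr, hmAdef, if_pos hqr, mul_one, vA, uA, one_div]
            rw [hMq]
            calc _ ≤ C₂ * (alpha D * Real.log q / q) := h
              _ ≤ |C₂| * (alpha D * Real.log q / q) := mul_le_mul_of_nonneg_right (le_abs_self _) (he0 q)
              _ ≤ CA * (alpha D * Real.log q / q) := by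
                  apply mul_le_mul_of_nonneg_right _ (he0 q)
                  rw [hCAdef]; linarith [abs_nonneg C₁, abs_nonneg C₃]
          · by_cases hqd : q ∣ d
            · have hqdr : q ∣ d * r := dvd_mul_of_dvd_left hqd r
              have hcopr : Nat.Coprime q r := (Nat.Prime.coprime_iff_not_dvd hqp).mpr hqr
              have h := h3' j hj d r hd hr hdr q hqp s hcond hqd hcopr
              have hMq : M q = (1 - uA q - vA χ q * uA q) / ((1 - vA χ q * uA q) * (1 - uA q)) := by
                simp only [hMdef, if_pos hqdr, hmAdef, if_neg hqr, vA, uA]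
                rw [div_mul_eq_div_div_swap]
                ring
              rw [hMq]
              calc _ ≤ C₃ * (alpha D * Real.log q / q) := h
                _ ≤ |C₃| * (alpha D * Real.log q / q) := mul_le_mul_of_nonneg_right (le_abs_self _) (he0 q)
                _ ≤ CA * (alpha D * Real.log q / q) := by
                    apply mul_le_mul_of_nonneg_right _ (he0 q)
                    rw [hCAdef]; linarith [abs_nonneg C₁, abs_nonneg C₂]
            · have hqdr : ¬ q ∣ d * r := fun h' => ((Nat.Prime.dvd_mul hqp).mp h').elim hqd hqr
              have hcop' : Nat.Coprime q (d * r) := (Nat.Prime.coprime_iff_not_dvd hqp).mpr hqdr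
              have h := h1' j hj d r hd hr hdr q hqp s hcond hcop'
              have hMq : M q = 1 := by simp only [hMdef, if_neg hqdr]
              rw [hMq]
              calc _ ≤ C₁ * (alpha D * Real.log q / q) := h
                _ ≤ |C₁| * (alpha D * Real.log q / q) := mul_le_mul_of_nonneg_right (le_abs_self _) (he0 q)
                _ ≤ CA * (alpha D * Real.log q / q) := by
                    apply mul_le_mul_of_nonneg_right _ (he0 q)
                    rw [hCAdef]; linarith [abs_nonneg C₂, abs_nonneg C₃]
      have hpert := norm_prod_sub_prod_le_abs (Nat.primesBelow D) (fun q => frakt c' χ j d r s q) M B e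
        hB_M hB1 he_q
      -- `Σ e ≤ 2CAπ/ℓ⁸ ≤ 1`
      have hSumLog : ∑ q ∈ Nat.primesBelow D, Real.log q / q ≤ 2 * ell D :=
        sum_log_div_primesBelow_le (D := D) (by linarith only [hℓ3'])
      have hSumE : ∑ q ∈ Nat.primesBelow D, e q ≤ 2 * CA * π / ell D ^ 8 := by
        simp only [hedef]
        rw [← Finset.mul_sum]
        have : ∑ q ∈ Nat.primesBelow D, alpha D * Real.log q / q =
            alpha D * ∑ q ∈ Nat.primesBelow D, Real.log q / q := by
          rw [Finset.mul_sum]; refine Finset.sum_congr rfl fun q _ => ?_; ring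
        rw [this]
        calc CA * (alpha D * ∑ q ∈ Nat.primesBelow D, Real.log q / q) ≤ CA * (alpha D * (2 * ell D)) := by
              gcongr
          _ = 2 * CA * (alpha D * ell D) := by ring
          _ = 2 * CA * π / ell D ^ 8 := by rw [hαℓ8]; ring
      have hSumE0 : 0 ≤ ∑ q ∈ Nat.primesBelow D, e q :=
        Finset.sum_nonneg fun q _ => by simp only [hedef]; exact mul_nonneg hCA0 (he0 q)
      have hε₁ : 2 * CA * π / ell D ^ 8 ≤ 1 := by
        rw [div_le_one hℓ8pos]
        have hℓ1' : 1 ≤ ell D := by linarith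
        calc 2 * CA * π ≤ ell D := by linarith
          _ = ell D ^ 1 := (pow_one _).symm
          _ ≤ ell D ^ 8 := pow_le_pow_right₀ hℓ1' (by norm_num)
      have hexp1 : Real.exp (∑ q ∈ Nat.primesBelow D, e q) - 1 ≤ 4 * CA * π / ell D ^ 8 := by
        have h := exp_sub_one_le_two_mul hSumE0 (le_trans hSumE hε₁)
        calc _ ≤ 2 * ∑ q ∈ Nat.primesBelow D, e q := h
          _ ≤ 2 * (2 * CA * π / ell D ^ 8) := by linarith
          _ = 4 * CA * π / ell D ^ 8 := by ring
      -- `∏ B ≤ Pi1`, `∏ M = ∏_A mA`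
      obtain ⟨A, hAdef⟩ : ∃ A : Finset ℕ, A = (Nat.primesBelow D).filter (fun q => q ∣ d * r) :=
        ⟨_, rfl⟩
      have hAsub : A ⊆ (d * r).primeFactors := by
        intro q hq
        rw [hAdef] at hq
        obtain ⟨hq1, hq2⟩ := Finset.mem_filter.mp hq
        exact Nat.mem_primeFactors.mpr ⟨(Nat.mem_primesBelow.mp hq1).2, hq2, hdr0⟩
      have hBprod : ∏ q ∈ Nat.primesBelow D, B q ≤ Pi1 := by
        have hsplit : ∏ q ∈ Nat.primesBelow D, B q =
            (∏ q ∈ A, (1 - (q : ℝ)⁻¹)⁻¹) * ∏ q ∈ (Nat.primesBelow D).filter (fun q => ¬ q ∣ d * r), (1 : ℝ) := by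
          rw [hBdef, hAdef]
          exact Finset.prod_ite (s := Nat.primesBelow D) (p := fun q => q ∣ d * r)
            (f := fun q => (1 - (q : ℝ)⁻¹)⁻¹) (g := fun _ => (1 : ℝ))
        rw [hsplit, Finset.prod_const_one, mul_one, hPi1def]
        classical
        exact prod_le_prod_of_subset_real _ hAsub
          (fun q hq => le_trans zero_le_one (one_le_inv_one_sub_inv
            (Nat.prime_of_mem_primeFactors (hAsub hq))))
          (fun q hq _ => one_le_inv_one_sub_inv (Nat.prime_of_mem_primeFactors hq))
      have hMprod : ∏ q ∈ Nat.primesBelow D, M q = ∏ q ∈ A, mA q := by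
        have hsplit : ∏ q ∈ Nat.primesBelow D, M q =
            (∏ q ∈ A, mA q) * ∏ q ∈ (Nat.primesBelow D).filter (fun q => ¬ q ∣ d * r), (1 : ℂ) := by
          rw [hMdef, hAdef]
          exact Finset.prod_ite (s := Nat.primesBelow D) (p := fun q => q ∣ d * r)
            (f := fun q => mA q) (g := fun _ => (1 : ℂ))
        rw [hsplit, Finset.prod_const_one, mul_one]
      -- `Π(d,r) = (∏_A mA)·R` with the tail `R` over the prime factors `≥ D`
      obtain ⟨A', hA'def⟩ : ∃ A' : Finset ℕ, A' = (d * r).primeFactors.filter (fun q => D ≤ q) :=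
        ⟨_, rfl⟩
      have hP1 : PiW χ d r = ∏ q ∈ (d * r).primeFactors, mA q := by
        rw [hmAdef]; exact PiW_eq_prod_main χ hd hr
      have hA_eq : (d * r).primeFactors.filter (fun q => q < D) = A := by
        rw [hAdef]
        ext q
        simp only [Finset.mem_filter, Nat.mem_primeFactors, Nat.mem_primesBelow]
        constructor
        · rintro ⟨⟨hqp, hqdr, _⟩, hqD⟩; exact ⟨⟨hqD, hqp⟩, hqdr⟩
        · rintro ⟨⟨hqD, hqp⟩, hqdr⟩; exact ⟨⟨hqp, hqdr, hdr0⟩, hqD⟩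
      have hA'_eq : (d * r).primeFactors.filter (fun q => ¬ q < D) = A' := by
        rw [hA'def]
        exact Finset.filter_congr (fun q _ => by rw [not_lt])
      have hPiW : PiW χ d r = (∏ q ∈ A, mA q) * ∏ q ∈ A', mA q := by
        rw [hP1, ← Finset.prod_filter_mul_prod_filter_not (d * r).primeFactors (fun q => q < D),
          hA_eq, hA'_eq]
      -- the tail `R` is within `ℓ^{-8}` of `1`
      have hcardA' : ((A'.card : ℝ)) ≤ ell D ^ 8 := by
        have h := card_large_primeFactors_mul_log_le (n := d * r) (D := D) (by omega) hD2
        rw [← hA'def] at h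
        rw [show Real.log (D : ℝ) = ell D from rfl] at h
        have hdrP : Real.log ((d * r : ℕ) : ℝ) ≤ ell D ^ 9 := by
          have hT1 : 1 ≤ bigT D ^ 2 := by
            have : 1 ≤ bigT D := by rw [bigT]; exact Real.one_le_exp (by positivity)
            nlinarith
          have hP0 : 0 < bigP D := by rw [bigP]; exact Real.exp_pos _
          have hdrP' : ((d * r : ℕ) : ℝ) ≤ bigP D := by
            calc ((d * r : ℕ) : ℝ) ≤ bigP D / bigT D ^ 2 := hdr.le
              _ ≤ bigP D := div_le_self hP0.le hT1
          have hdr0r : (0 : ℝ) < ((d * r : ℕ) : ℝ) := by exact_mod_cast Nat.pos_of_ne_zero hdr0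
          calc Real.log ((d * r : ℕ) : ℝ) ≤ Real.log (bigP D) := Real.log_le_log hdr0r hdrP'
            _ = ell D ^ 9 := by rw [bigP, Real.log_exp]
        have h2 : (A'.card : ℝ) * ell D ≤ ell D ^ 8 * ell D := by
          calc (A'.card : ℝ) * ell D ≤ Real.log ((d * r : ℕ) : ℝ) := h
            _ ≤ ell D ^ 9 := hdrP
            _ = ell D ^ 8 * ell D := by ring
        exact le_of_mul_le_mul_right h2 hℓ0
      have hR1 : ‖(∏ q ∈ A', mA q) - 1‖ ≤ (ell D ^ 8)⁻¹ := by
        have hpertR := norm_prod_sub_prod_le_abs A' mA (fun _ => (1 : ℂ)) (fun _ => (1 : ℝ))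
          (fun q => 2 / (q : ℝ)) (fun _ _ => by rw [norm_one]) (fun _ _ => le_refl _)
          (fun q hq => (norm_main_le χ hquad (Nat.prime_of_mem_primeFactors
            (Finset.mem_filter.mp (hA'def ▸ hq)).1) r).2)
        rw [Finset.prod_const_one, Finset.prod_const_one, one_mul] at hpertR
        have hSum2 : ∑ q ∈ A', 2 / (q : ℝ) ≤ 2 * ell D ^ 8 / D := by
          calc ∑ q ∈ A', 2 / (q : ℝ) ≤ ∑ q ∈ A', 2 / (D : ℝ) := by
                refine Finset.sum_le_sum fun q hq => ?_
                have hqD : (D : ℝ) ≤ q := by exact_mod_cast (Finset.mem_filter.mp (hA'def ▸ hq)).2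
                exact div_le_div_of_nonneg_left (by norm_num) hD0r hqD
            _ = (A'.card : ℝ) * (2 / D) := by rw [Finset.sum_const, nsmul_eq_mul]
            _ ≤ ell D ^ 8 * (2 / D) := by gcongr
            _ = 2 * ell D ^ 8 / D := by ring
        have hSum20 : 0 ≤ ∑ q ∈ A', 2 / (q : ℝ) := Finset.sum_nonneg fun q _ => by positivity
        have hε₂ : 2 * ell D ^ 8 / D ≤ 1 := by
          rw [div_le_one hD0r]
          have hℓ1' : 1 ≤ ell D := by linarith
          have : ell D ^ 8 ≤ ell D ^ 16 := pow_le_pow_right₀ hℓ1' (by norm_num)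
          linarith
        calc ‖(∏ q ∈ A', mA q) - 1‖ ≤ Real.exp (∑ q ∈ A', 2 / (q : ℝ)) - 1 := hpertR
          _ ≤ 2 * ∑ q ∈ A', 2 / (q : ℝ) := exp_sub_one_le_two_mul hSum20 (le_trans hSum2 hε₂)
          _ ≤ 2 * (2 * ell D ^ 8 / D) := by linarith
          _ ≤ (ell D ^ 8)⁻¹ := by
              rw [show 2 * (2 * ell D ^ 8 / (D : ℝ)) = 4 * ell D ^ 8 / D by ring,
                div_le_iff₀ hD0r, inv_mul_eq_div, le_div_iff₀ hℓ8pos]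
              calc 4 * ell D ^ 8 * ell D ^ 8 = 4 * ell D ^ 16 := by ring
                _ ≤ (D : ℝ) := hD16
      -- `‖∏_A mA‖ ≤ Pi1`
      have hAm : ‖∏ q ∈ A, mA q‖ ≤ Pi1 := by
        rw [Complex.norm_prod]
        calc ∏ q ∈ A, ‖mA q‖ ≤ ∏ q ∈ A, (1 - (q : ℝ)⁻¹)⁻¹ :=
              Finset.prod_le_prod (fun _ _ => norm_nonneg _) fun q hq =>
                (norm_main_le χ hquad (Nat.prime_of_mem_primeFactors (hAsub hq)) r).1
          _ ≤ Pi1 := by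
              rw [hPi1def]
              classical
              exact prod_le_prod_of_subset_real _ hAsub
                (fun q hq => le_trans zero_le_one (one_le_inv_one_sub_inv
                  (Nat.prime_of_mem_primeFactors (hAsub hq))))
                (fun q hq _ => one_le_inv_one_sub_inv (Nat.prime_of_mem_primeFactors hq))
      -- assembly
      have hid : U s - PiW χ d r = (U s - T) + (T - ∏ q ∈ Nat.primesBelow D, M q) +
          (∏ q ∈ A, mA q) * (1 - ∏ q ∈ A', mA q) := by
        rw [hPiW, hMprod]; ring
      rw [hid]
      have hT1 : ‖T - ∏ q ∈ Nat.primesBelow D, M q‖ ≤ Pi1 * (4 * CA * π / ell D ^ 8) := by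
        calc _ ≤ (∏ q ∈ Nat.primesBelow D, B q) * (Real.exp (∑ q ∈ Nat.primesBelow D, e q) - 1) := hpert
          _ ≤ Pi1 * (4 * CA * π / ell D ^ 8) := by
              have h0 : 0 ≤ Real.exp (∑ q ∈ Nat.primesBelow D, e q) - 1 := by
                linarith [Real.add_one_le_exp (∑ q ∈ Nat.primesBelow D, e q)]
              exact mul_le_mul hBprod hexp1 h0 hPi10
      have hT2 : ‖(∏ q ∈ A, mA q) * (1 - ∏ q ∈ A', mA q)‖ ≤ Pi1 * (ell D ^ 8)⁻¹ := by
        rw [norm_mul, norm_sub_rev]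
        exact mul_le_mul hAm hR1 (norm_nonneg _) hPi10
      have hT0 : ‖U s - T‖ ≤ |C_R| * (ell D ^ 8)⁻¹ := by
        calc ‖U s - T‖ ≤ C_R * (D : ℝ) ^ (-c) := hRs
          _ ≤ |C_R| * (D : ℝ) ^ (-c) := mul_le_mul_of_nonneg_right (le_abs_self _) (Real.rpow_nonneg hD0r.le _)
          _ ≤ |C_R| * (ell D ^ 8)⁻¹ := mul_le_mul_of_nonneg_left hDc8 (abs_nonneg _)
      calc _ ≤ ‖(U s - T) + (T - ∏ q ∈ Nat.primesBelow D, M q)‖ +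
            ‖(∏ q ∈ A, mA q) * (1 - ∏ q ∈ A', mA q)‖ := norm_add_le _ _
        _ ≤ (|C_R| * (ell D ^ 8)⁻¹ + Pi1 * (4 * CA * π / ell D ^ 8)) + Pi1 * (ell D ^ 8)⁻¹ := by
            gcongr
            exact le_trans (norm_add_le _ _) (add_le_add hT0 hT1)
        _ ≤ Ciii * (ell D ^ 8)⁻¹ * Pi1 := by
            rw [hCiiidef, div_eq_mul_inv]
            have h1 : |C_R| * (ell D ^ 8)⁻¹ ≤ |C_R| * (ell D ^ 8)⁻¹ * Pi1 :=
              le_mul_of_one_le_right (mul_nonneg (abs_nonneg _) (inv_nonneg.mpr hℓ8pos.le)) hPi11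
            have e4 : (|C_R| + 4 * π * CA + 1) * (ell D ^ 8)⁻¹ * Pi1 =
                |C_R| * (ell D ^ 8)⁻¹ * Pi1 + (Pi1 * (4 * CA * π * (ell D ^ 8)⁻¹) + Pi1 * (ell D ^ 8)⁻¹) := by
              ring
            rw [e4]
            linarith only [h1]
    -- (b) extension to the CLOSED ball by continuity of `U`
    intro s hs
    have h5α : (5 * alpha D) ≠ 0 := by positivity
    have hball9 : Metric.closedBall (1 : ℂ) (5 * alpha D) ⊆ {z : ℂ | 9 / 10 < z.re} := by
      intro z hz
      rw [Metric.mem_closedBall, dist_eq_norm] at hz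
      have h := Complex.abs_re_le_norm (z - 1)
      rw [Complex.sub_re, Complex.one_re] at h
      have := (abs_le.mp (le_trans h hz)).1
      show 9 / 10 < z.re
      linarith [hα_le]
    have hcl : closure (Metric.ball (1 : ℂ) (5 * alpha D)) = Metric.closedBall (1 : ℂ) (5 * alpha D) :=
      closure_ball (1 : ℂ) h5α
    have hcontU : ContinuousOn (fun z => ‖U z - PiW χ d r‖) (closure (Metric.ball (1 : ℂ) (5 * alpha D))) := by
      rw [hcl]
      exact ((hUcont.mono hball9).sub continuousOn_const).norm
    have hmem : s ∈ closure (Metric.ball (1 : ℂ) (5 * alpha D)) := by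
      rw [hcl, Metric.mem_closedBall, dist_eq_norm]; exact hs
    have hclaim : ‖U s - PiW χ d r‖ ≤ Ciii * (ell D ^ 8)⁻¹ * Pi1 :=
      le_on_closure (f := fun z => ‖U z - PiW χ d r‖) (g := fun _ => Ciii * (ell D ^ 8)⁻¹ * Pi1)
        (fun z hz => key z (by rwa [Metric.mem_ball, dist_eq_norm] at hz)) hcontU continuousOn_const hmem
    calc ‖U s - PiW χ d r‖ ≤ Ciii * (ell D ^ 8)⁻¹ * Pi1 := hclaim
      _ ≤ Cmax * (ell D ^ 8)⁻¹ * Pi1 := by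
          have hinv0 : 0 ≤ (ell D ^ 8)⁻¹ := inv_nonneg.mpr hℓ8pos.le
          gcongr

end Literature.NumberTheory.LFunctions.Zhang2022.Repair.Gap

end
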